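/-
Copyright: the b2b-balaban T⁴-continuum CRUX team, row NE7b leaf lineage `t4-ne7b-formalise-leaf-02` (gen 135). Project licence.
-/
import Summits.QuantumFields.BalabanUV.T4Continuum.Spine.NE7b.AdmissibleFloorSeminormTwoFamilies

/-!
# THE IMS ERROR LETTER BY THE SUMMED-SQUARE ROUTE: one letter `Σ_s (h_s(c) − h_s(c_j))² ≤ Λ²` on the bonds of a term replaces the pair (Lip) `|h_s(c) − h_s(c_j)| ≤ λ`,
# (mult) `≤ μ` varying cutoffs — `Σ_j Σ_s ρ_{s,j}(x)² ≤ ℓ²Λ²ab·Σ_c‖x c‖²` (Cauchy–Schwarz over the term with the `s`-sum inside), so the seminorm-IMS floors of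
# `…AdmissibleFloorSeminormTerms` ∕ `…AdmissibleFloorSeminormTwoFamilies` hold with `ε = ℓ²Λ²ab` (one family) ∕ `ε = ℓ₁²Λ₁²a₁b₁ + ℓ₂²Λ₂²a₂b₂` (two) — NO `μ`
# (row NE7b, node U5c; residual (R2′) family (2), letter (ℓ1); the refuter's located item Q-v128-1 «where the last 2^{#A} lives», PRICING-NE7b v128 F762)

Cell `pub-balaban`, sub-cell `t4`, spine estimate NE7b (`T4WeightBudget.RelWeightBound`; the cell's OWN estimate — NOT PRINTED in [Bałaban 1983–89],
NOT PROVED).  Crux-route work under `Spine/NE7b/` by a row leaf (`t4-ne7b-formalise-leaf-02`, E-side ∕ key-readings ∕ lattice-geometry lineage, gen 135)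
under FREEZE (0)'s crux-prover clause; NOTHING of Bałaban's is asserted; no `def`; zero `sorry`; no `T4Continuum/Support` leaf; a SIBLING of leaf-05's
`…AdmissibleFloorSeminormIMS` (AFSI) ∕ `…Terms` (AFST) ∕ `…TwoFamilies` (AFS2) — nothing there is edited, their junctions are consumed BY NAME.
Import: `…AdmissibleFloorSeminormTwoFamilies` (AFS2: `ims_floor_of_commutator_two`; through it AFSI `ims_floor_of_commutator`, `norm_term_cutoff_le`, AFST
`sum_normSq_cutoff`, and `…SqrtFormPerturbationLetters.sum_sum_mem_eq`).

WHY.  AFSI `ims_error_of_letters` values the IMS error of linear local terms `T_j x = Σ_{c∈inc j} R_{j,c}(x c)` (`‖R_{j,c}v‖ ≤ ℓ‖v‖`) under a quadratic partition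
`{h_s}` as `Σ_j Σ_s ρ_{s,j}(x)² ≤ μℓ²λ²ab·Σ_c‖x c‖²`, `ρ_{s,j}(x) = ℓΣ_{c∈inc j}|h_s(c) − h_s(c_j)|‖x c‖`, from a SUP letter `λ` per cutoff and a COUNT `μ` of the
cutoffs varying on a term.  The refuter's pricing desk located (Q-v128-1, zero ask) that the product `μλ²` over-charges the textbook localisation error
`Σ_□ |∇χ_□|²`: with the `s`-sum INSIDE, one summed-square letter `hsq : Σ_s (h_s(c) − h_s(c_j))² ≤ Λ²` for the bonds `c` of the term gives
`Σ_s ρ_{s,j}(x)² ≤ ℓ²·(Σ_{c∈inc j} Σ_s(h_s(c) − h_s(c_j))²)·(Σ_{c∈inc j}‖x c‖²) ≤ ℓ²aΛ²·Σ_{c∈inc j}‖x c‖²` (Cauchy–Schwarz on `inc j`), and the incidence count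
`b` finishes: `ε′ = ℓ²Λ²ab`.  For product partitions `Λ` is the `ℓ²(cubes)` displacement letter the torus files already build (`…SineTentSqLetter`: for the sine
tent `Λ = D·π∕(2L)` EXACTLY, the same number as the sup letter `λ`), so `μ` (`2^d` for plaquettes, `(n^{d+1}+1)·2^d` for the average terms) drops out of `ε`.

WHAT IS PROVED ([folklore]):
* §1 `sum_sum_mem_le` (double count: `Σ_j Σ_{c∈inc j} g c ≤ b·Σ_c g c` for `g ≥ 0`, `#{j : c ∈ inc j} ≤ b`); **`ims_error_of_sq_letter`** —
  `hsq : ∀ j, ∀ c ∈ inc j, Σ_s (h_s c − h_s (ref j))² ≤ Λ²`, `#inc j ≤ a`, `#{j : c ∈ inc j} ≤ b` ⊢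
  `Σ_j Σ_s (ℓ·Σ_{c∈inc j}|h_s c − h_s(ref j)|·‖x c‖)² ≤ ℓ²Λ²ab·Σ_c‖x c‖²` (AFSI's `ρ`-shape VERBATIM, so its junctions consume it).
* §2 **`ims_floor_of_linear_terms_sq`** — AFST `ims_floor_of_linear_terms` with `(hlip, hμ)` replaced by `hsq`:
  `((c_loc − (1+t⁻¹)·ℓ²Λ²ab)∕(1+t))·Σ_c‖x c‖² ≤ F x` on `good` (AFSI `ims_floor_of_commutator` BY NAME).
* §3 **`ims_floor_of_linear_terms_two_sq`** — AFS2 `ims_floor_of_linear_terms_two` likewise: `((c_loc − (1+t⁻¹)·(ℓ₁²Λ₁²a₁b₁ + ℓ₂²Λ₂²a₂b₂))∕(1+t))·Σ_c‖x c‖² ≤ F x`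
  (AFS2 `ims_floor_of_commutator_two` BY NAME).
* §4 toy: one term, one cube, `R = id` on `ℝ`, `h ≡ 1` (`Λ = 0`): the floor `((1 − 2·0)∕2)·‖x‖² ≤ ‖x‖²` (`example`).

NOT HERE (honest): the letter `Λ` BY VALUE (the torus files), the local floors `c_loc`, the term data; anything of Bałaban's.  BY-NAME EFFECT ON THE WALL: NONE
(the (h2) slot's IMS error letter by the textbook route; the wall is (R2)).  NE7b NOT PRINTED ∕ NOT PROVED; spine PROVED 0∕9; rung (B)+1 on ONE finite T⁴ —
NOT infinite volume, NOT the mass gap, NOT Clay.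
HONEST DEPENDENCY: continuum YM on T⁴ ⇐ BetaPertH ∧ nine spine estimates (0/9 proved); BetaPertH ⇐ (D1) ∧ (D4) ∧ CAP+tail; G-an2-4 gates asym, D1 and NE2/3/4.
-/

set_option autoImplicit false

noncomputable section

open Finset
open Summit.QuantumFields.BalabanUV.T4Continuum.NE7b.AdmissibleFloorSeminormIMS (ims_floor_of_commutator norm_term_cutoff_le)
open Summit.QuantumFields.BalabanUV.T4Continuum.NE7b.AdmissibleFloorSeminormTerms (sum_normSq_cutoff)
open Summit.QuantumFields.BalabanUV.T4Continuum.NE7b.AdmissibleFloorSeminormTwoFamilies (ims_floor_of_commutator_two)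
open Summit.QuantumFields.BalabanUV.T4Continuum.NE7b.SqrtFormPerturbationLetters (sum_sum_mem_eq)

namespace Summit.QuantumFields.BalabanUV.T4Continuum.NE7b.AdmissibleFloorSqLetter

variable {J J₂ ι C : Type*} [Fintype J] [Fintype J₂] [Fintype ι] [Fintype C]
variable {W V V₂ : Type*} [NormedAddCommGroup W] [NormedSpace ℝ W] [NormedAddCommGroup V] [NormedSpace ℝ V]
  [NormedAddCommGroup V₂] [NormedSpace ℝ V₂]

/-! ## §1 The error letter from ONE summed-square letter: `ε′ = ℓ²Λ²ab` -/

omit [Fintype ι] [NormedAddCommGroup W] [NormedSpace ℝ W] [NormedAddCommGroup V] [NormedSpace ℝ V] [Fintype J₂]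
  [NormedAddCommGroup V₂] [NormedSpace ℝ V₂] in
/-- Double count: `Σ_j Σ_{c∈inc j} g c ≤ b·Σ_c g c` for `g ≥ 0` when every bond lies in at most `b` terms. [folklore] -/
theorem sum_sum_mem_le [DecidableEq C] (inc : J → Finset C) (g : C → ℝ) (hg : ∀ c, 0 ≤ g c) {b : ℕ}
    (hb : ∀ c, (Finset.univ.filter fun j => c ∈ inc j).card ≤ b) :
    ∑ j, ∑ c ∈ inc j, g c ≤ b * ∑ c, g c := by
  rw [sum_sum_mem_eq inc g, Finset.mul_sum]
  exact Finset.sum_le_sum fun c _ => mul_le_mul_of_nonneg_right (by exact_mod_cast hb c) (hg c)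

omit [NormedSpace ℝ W] [NormedAddCommGroup V] [NormedSpace ℝ V] [Fintype J₂] [NormedAddCommGroup V₂] [NormedSpace ℝ V₂] in
/-- **THE IMS ERROR LETTER BY THE SUMMED-SQUARE ROUTE**: `Σ_s (h_s c − h_s(ref j))² ≤ Λ²` on the bonds of every term, `#inc j ≤ a`, `#{j : c ∈ inc j} ≤ b` ⊢
`Σ_j Σ_s (ℓ·Σ_{c∈inc j}|h_s c − h_s(ref j)|·‖x c‖)² ≤ ℓ²Λ²ab·Σ_c‖x c‖²` — AFSI `ims_error_of_letters`' conclusion with `μλ²` replaced by `Λ²` (Cauchy–Schwarz over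
`inc j` with the `s`-sum inside; the refuter's Q-v128-1). [folklore] -/
theorem ims_error_of_sq_letter [DecidableEq C] (inc : J → Finset C) (h : ι → C → ℝ) (ref : J → C) {ℓ Λ : ℝ}
    (hsq : ∀ j, ∀ c ∈ inc j, ∑ s, (h s c - h s (ref j)) ^ 2 ≤ Λ ^ 2)
    {a b : ℕ} (ha : ∀ j, (inc j).card ≤ a) (hb : ∀ c, (Finset.univ.filter fun j => c ∈ inc j).card ≤ b)
    (x : C → W) :
    ∑ j, ∑ s, (ℓ * ∑ c ∈ inc j, |h s c - h s (ref j)| * ‖x c‖) ^ 2 ≤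
      ℓ ^ 2 * Λ ^ 2 * a * b * ∑ c, ‖x c‖ ^ 2 := by
  -- per term and cutoff: Cauchy–Schwarz over the bonds of the term
  have hcs : ∀ j s, (∑ c ∈ inc j, |h s c - h s (ref j)| * ‖x c‖) ^ 2
      ≤ (∑ c ∈ inc j, (h s c - h s (ref j)) ^ 2) * ∑ c ∈ inc j, ‖x c‖ ^ 2 := by
    intro j s
    have hc := Finset.sum_mul_sq_le_sq_mul_sq (inc j) (fun c => |h s c - h s (ref j)|) (fun c => ‖x c‖)
    simp only [sq_abs] at hc
    exact hc
  -- per term: the `s`-sum inside, then `hsq` on each bond and `#inc j ≤ a`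
  have hterm : ∀ j, ∑ s, (ℓ * ∑ c ∈ inc j, |h s c - h s (ref j)| * ‖x c‖) ^ 2
      ≤ ℓ ^ 2 * (a * Λ ^ 2) * ∑ c ∈ inc j, ‖x c‖ ^ 2 := by
    intro j
    have hX : 0 ≤ ∑ c ∈ inc j, ‖x c‖ ^ 2 := Finset.sum_nonneg fun c _ => sq_nonneg _
    have hin : ∑ s, ∑ c ∈ inc j, (h s c - h s (ref j)) ^ 2 ≤ a * Λ ^ 2 := by
      rw [Finset.sum_comm]
      calc ∑ c ∈ inc j, ∑ s, (h s c - h s (ref j)) ^ 2 ≤ ∑ _c ∈ inc j, Λ ^ 2 := Finset.sum_le_sum fun c hc => hsq j c hc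
        _ = (inc j).card * Λ ^ 2 := by rw [sum_const, nsmul_eq_mul]
        _ ≤ a * Λ ^ 2 := mul_le_mul_of_nonneg_right (by exact_mod_cast ha j) (sq_nonneg _)
    calc ∑ s, (ℓ * ∑ c ∈ inc j, |h s c - h s (ref j)| * ‖x c‖) ^ 2
        = ℓ ^ 2 * ∑ s, (∑ c ∈ inc j, |h s c - h s (ref j)| * ‖x c‖) ^ 2 := by
          rw [Finset.mul_sum]; exact Finset.sum_congr rfl fun s _ => by ring
      _ ≤ ℓ ^ 2 * ∑ s, (∑ c ∈ inc j, (h s c - h s (ref j)) ^ 2) * ∑ c ∈ inc j, ‖x c‖ ^ 2 :=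
          mul_le_mul_of_nonneg_left (Finset.sum_le_sum fun s _ => hcs j s) (sq_nonneg _)
      _ = ℓ ^ 2 * ((∑ s, ∑ c ∈ inc j, (h s c - h s (ref j)) ^ 2) * ∑ c ∈ inc j, ‖x c‖ ^ 2) := by rw [Finset.sum_mul]
      _ ≤ ℓ ^ 2 * ((a * Λ ^ 2) * ∑ c ∈ inc j, ‖x c‖ ^ 2) :=
          mul_le_mul_of_nonneg_left (mul_le_mul_of_nonneg_right hin hX) (sq_nonneg _)
      _ = ℓ ^ 2 * (a * Λ ^ 2) * ∑ c ∈ inc j, ‖x c‖ ^ 2 := by ring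
  -- over the terms: the incidence count `b`
  have hdc := sum_sum_mem_le inc (fun c => ‖x c‖ ^ 2) (fun c => sq_nonneg _) hb
  calc ∑ j, ∑ s, (ℓ * ∑ c ∈ inc j, |h s c - h s (ref j)| * ‖x c‖) ^ 2
      ≤ ∑ j, ℓ ^ 2 * (a * Λ ^ 2) * ∑ c ∈ inc j, ‖x c‖ ^ 2 := Finset.sum_le_sum fun j _ => hterm j
    _ = ℓ ^ 2 * (a * Λ ^ 2) * ∑ j, ∑ c ∈ inc j, ‖x c‖ ^ 2 := by rw [← Finset.mul_sum]
    _ ≤ ℓ ^ 2 * (a * Λ ^ 2) * (b * ∑ c, ‖x c‖ ^ 2) := mul_le_mul_of_nonneg_left hdc (by positivity)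
    _ = ℓ ^ 2 * Λ ^ 2 * a * b * ∑ c, ‖x c‖ ^ 2 := by ring

/-! ## §2 The one-family floor with `ε = ℓ²Λ²ab` -/

omit [Fintype J₂] [NormedAddCommGroup V₂] [NormedSpace ℝ V₂] in
/-- **THE SEMINORM-IMS FLOOR FOR LINEAR LOCAL TERMS, SUMMED-SQUARE ROUTE** (AFST `ims_floor_of_linear_terms` with `(hlip, hμ)` ↦ `hsq`): terms
`T_j x = Σ_{c∈inc j} R_{j,c}(x c)` (`‖R_{j,c}v‖ ≤ ℓ‖v‖`), a quadratic partition `h` acting by scalars with `Σ_s (h_s c − h_s(ref j))² ≤ Λ²` on `inc j`, counts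
`#inc j ≤ a`, `#{j : c ∈ inc j} ≤ b`; local floors `c_loc` on `good`, `Σ_j‖T_j x‖² ≤ F x` on `good` ⊢ `((c_loc − (1+t⁻¹)·ℓ²Λ²ab)∕(1+t))·Σ_c‖x c‖² ≤ F x`. [folklore] -/
theorem ims_floor_of_linear_terms_sq [DecidableEq C] (inc : J → Finset C) (R : J → C → W →ₗ[ℝ] V) {ℓ : ℝ}
    (hR : ∀ j c v, ‖R j c v‖ ≤ ℓ * ‖v‖)
    (h : ι → C → ℝ) (hpart : ∀ c, ∑ s, h s c ^ 2 = 1) (ref : J → C)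
    {Λ : ℝ} (hsq : ∀ j, ∀ c ∈ inc j, ∑ s, (h s c - h s (ref j)) ^ 2 ≤ Λ ^ 2)
    {a b : ℕ} (ha : ∀ j, (inc j).card ≤ a) (hb : ∀ c, (Finset.univ.filter fun j => c ∈ inc j).card ≤ b)
    (good : (C → W) → Prop) {cloc : ℝ}
    (hloc : ∀ s x, good x → cloc * ∑ c, ‖h s c • x c‖ ^ 2 ≤ ∑ j, ‖∑ c ∈ inc j, R j c (h s c • x c)‖ ^ 2)
    (F : (C → W) → ℝ) (hF : ∀ x, good x → ∑ j, ‖∑ c ∈ inc j, R j c (x c)‖ ^ 2 ≤ F x)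
    {t : ℝ} (ht : 0 < t) (x : C → W) (hx : good x) :
    (cloc - (1 + t⁻¹) * (ℓ ^ 2 * Λ ^ 2 * a * b)) / (1 + t) * ∑ c, ‖x c‖ ^ 2 ≤ F x :=
  ims_floor_of_commutator (fun j (x : C → W) => ‖∑ c ∈ inc j, R j c (x c)‖) (fun s x c => h s c • x c)
    (fun s j => h s (ref j)) (fun s j x => ℓ * ∑ c ∈ inc j, |h s c - h s (ref j)| * ‖x c‖)
    (fun j => (hpart (ref j)).le) (fun _ _ => norm_nonneg _)
    (fun s j x => norm_term_cutoff_le inc R hR h ref x s j)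
    (fun x => ∑ c, ‖x c‖ ^ 2) good (fun x _ => ims_error_of_sq_letter inc h ref hsq ha hb x)
    (sum_normSq_cutoff h hpart) hloc F hF ht x hx

/-! ## §3 The two-family floor with `ε = ℓ₁²Λ₁²a₁b₁ + ℓ₂²Λ₂²a₂b₂` -/

/-- **THE TWO-FAMILY SEMINORM-IMS FLOOR, SUMMED-SQUARE ROUTE** (AFS2 `ims_floor_of_linear_terms_two` with `(hlip_i, hμ_i)` ↦ `hsq_i`):
`((c_loc − (1+t⁻¹)·(ℓ₁²Λ₁²a₁b₁ + ℓ₂²Λ₂²a₂b₂))∕(1+t))·Σ_c‖x c‖² ≤ F x` on `good`. [folklore] -/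
theorem ims_floor_of_linear_terms_two_sq [DecidableEq C]
    (inc₁ : J → Finset C) (R₁ : J → C → W →ₗ[ℝ] V) {ℓ₁ : ℝ} (hR₁ : ∀ j c v, ‖R₁ j c v‖ ≤ ℓ₁ * ‖v‖)
    (inc₂ : J₂ → Finset C) (R₂ : J₂ → C → W →ₗ[ℝ] V₂) {ℓ₂ : ℝ} (hR₂ : ∀ j c v, ‖R₂ j c v‖ ≤ ℓ₂ * ‖v‖)
    (h : ι → C → ℝ) (hpart : ∀ c, ∑ s, h s c ^ 2 = 1) (ref₁ : J → C) (ref₂ : J₂ → C)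
    {Λ₁ Λ₂ : ℝ}
    (hsq₁ : ∀ j, ∀ c ∈ inc₁ j, ∑ s, (h s c - h s (ref₁ j)) ^ 2 ≤ Λ₁ ^ 2)
    (hsq₂ : ∀ j, ∀ c ∈ inc₂ j, ∑ s, (h s c - h s (ref₂ j)) ^ 2 ≤ Λ₂ ^ 2)
    {a₁ b₁ a₂ b₂ : ℕ}
    (ha₁ : ∀ j, (inc₁ j).card ≤ a₁) (hb₁ : ∀ c, (Finset.univ.filter fun j => c ∈ inc₁ j).card ≤ b₁)
    (ha₂ : ∀ j, (inc₂ j).card ≤ a₂) (hb₂ : ∀ c, (Finset.univ.filter fun j => c ∈ inc₂ j).card ≤ b₂)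
    (good : (C → W) → Prop) {cloc : ℝ}
    (hloc : ∀ s x, good x → cloc * ∑ c, ‖h s c • x c‖ ^ 2 ≤
      ∑ j, ‖∑ c ∈ inc₁ j, R₁ j c (h s c • x c)‖ ^ 2 + ∑ j, ‖∑ c ∈ inc₂ j, R₂ j c (h s c • x c)‖ ^ 2)
    (F : (C → W) → ℝ)
    (hF : ∀ x, good x → ∑ j, ‖∑ c ∈ inc₁ j, R₁ j c (x c)‖ ^ 2 + ∑ j, ‖∑ c ∈ inc₂ j, R₂ j c (x c)‖ ^ 2 ≤ F x)
    {t : ℝ} (ht : 0 < t) (x : C → W) (hx : good x) :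
    (cloc - (1 + t⁻¹) * (ℓ₁ ^ 2 * Λ₁ ^ 2 * a₁ * b₁ + ℓ₂ ^ 2 * Λ₂ ^ 2 * a₂ * b₂)) / (1 + t) * ∑ c, ‖x c‖ ^ 2 ≤ F x :=
  ims_floor_of_commutator_two
    (fun j (x : C → W) => ‖∑ c ∈ inc₁ j, R₁ j c (x c)‖) (fun j (x : C → W) => ‖∑ c ∈ inc₂ j, R₂ j c (x c)‖)
    (fun s x c => h s c • x c)
    (fun s j => h s (ref₁ j)) (fun s j => h s (ref₂ j))
    (fun s j x => ℓ₁ * ∑ c ∈ inc₁ j, |h s c - h s (ref₁ j)| * ‖x c‖)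
    (fun s j x => ℓ₂ * ∑ c ∈ inc₂ j, |h s c - h s (ref₂ j)| * ‖x c‖)
    (fun j => (hpart (ref₁ j)).le) (fun j => (hpart (ref₂ j)).le)
    (fun _ _ => norm_nonneg _) (fun _ _ => norm_nonneg _)
    (fun s j x => norm_term_cutoff_le inc₁ R₁ hR₁ h ref₁ x s j)
    (fun s j x => norm_term_cutoff_le inc₂ R₂ hR₂ h ref₂ x s j)
    (fun x => ∑ c, ‖x c‖ ^ 2) good
    (fun x _ => ims_error_of_sq_letter inc₁ h ref₁ hsq₁ ha₁ hb₁ x)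
    (fun x _ => ims_error_of_sq_letter inc₂ h ref₂ hsq₂ ha₂ hb₂ x)
    (sum_normSq_cutoff h hpart) hloc F hF ht x hx

/-! ## §4 Toy: one term, one cube, `R = id` on `ℝ`, `h ≡ 1` -/

section Toy

/- `J = ι = C = Unit`, `W = V = ℝ`, `inc _ = {()}`, `R = id` (`ℓ = 1`), `h ≡ 1` (`Λ = 0`), `a = b = 1`, `good = True`, `c_loc = 1`, `F x = Σ‖x c‖²`, `t = 1`:
the floor `((1 − 2·(1·0·1·1))∕2)·‖x‖² ≤ ‖x‖²`. -/
example (x : Unit → ℝ) :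
    (1 - (1 + (1 : ℝ)⁻¹) * ((1 : ℝ) ^ 2 * (0 : ℝ) ^ 2 * (1 : ℕ) * (1 : ℕ))) / (1 + 1) * ∑ c, ‖x c‖ ^ 2 ≤ ∑ c, ‖x c‖ ^ 2 := by
  have key := ims_floor_of_linear_terms_sq (J := Unit) (ι := Unit) (C := Unit) (W := ℝ) (V := ℝ)
    (fun _ => {()}) (fun _ _ => LinearMap.id) (ℓ := 1) (fun _ _ v => by simp)
    (fun _ _ => (1 : ℝ)) (fun _ => by simp) (fun _ => ()) (Λ := 0) (fun _ _ _ => by simp)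
    (a := 1) (b := 1) (fun _ => by simp) (fun _ => by simp)
    (fun _ => True) (cloc := 1) (fun _ y _ => by simp) (fun y => ∑ c, ‖y c‖ ^ 2) (fun y _ => by simp) one_pos x trivial
  simpa using key

end Toy

end Summit.QuantumFields.BalabanUV.T4Continuum.NE7b.AdmissibleFloorSqLetter

end
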